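import Literature.NumberTheory.Transcendental.KZSemiCanonicalReductionProofs
import Literature.NumberTheory.Transcendental.EllIterRep

/-!
# `VolumeFormOffPlane` (stmt-KontsevichZagierPeriods-14935) — line `Sketch`,
stub `stub_triExists` (integrand-`1` representations exist on the three triangle shapes)

Dimension `3`, coordinates `x = p 0`, `y = p 1` and slack `z = p 2` subject to
`0 < z ∧ z · (x · y) < 1`. The three shapes are

* the log-triangle `T(a, b, i, j, c) = {a < x, b < y, xⁱ yʲ < c, slack}` (`a, b > 0`, `a, b, c`
  real algebraic, `i, j ≥ 1`);
* the middle triangle `{1 < y < x < g, slack}` (`g` real algebraic);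
* the north-east triangle `{0 < x < g, y < g, g < x y, slack}` (`g` real algebraic).

Each is `ℚ`-semialgebraic (polynomial inequalities with rational coefficients, half-spaces and
sublevel sets `{P < c}` / `{c < P}` with real-algebraic constants `c`, which are `ℚ`-definable) and
bounded (it lies in a compact coordinate box), hence of finite volume; `KZ.exists_oneRep` then
provides the representation `∫ 1` over it.

Sources: Kontsevich–Zagier 2001, §1.1 (semialgebraic domains, "rational" may be replaced by
"algebraic"); Bochnak–Coste–Roy 1998, §2.2.
-/

noncomputable section

open MeasureTheory Set MvPolynomial
open Literature.NumberTheory.Transcendental Literature.ModelTheory.ExponentialFields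

namespace Summit.KontsevichZagierPeriods.SymplecticScissors.LogPolytope

/-! ## Sublevel and superlevel sets of rational polynomials at real-algebraic levels -/

/-- `{x | P(x) < c}` is `ℚ`-semialgebraic for `P ∈ ℚ[X₀, …, X_{n-1}]` and `c` real algebraic: it is
the negativity set of the `ℚ`-semialgebraic function `P − c`. [folklore] -/
theorem tre_isSemialgebraic_setOf_aeval_lt_const {n : ℕ} (P : MvPolynomial (Fin n) ℚ) {c : ℝ}
    (hc : IsAlgebraic ℚ c) : IsSemialgebraic ℚ {x : Fin n → ℝ | aeval x P < c} := by
  have h : IsSemialgebraicFunOn ℚ (univ : Set (Fin n → ℝ)) (fun x => aeval x P - c) :=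
    (IsSemialgebraicFunOn.sub_holds (isSemialgebraicFunOn_aeval isSemialgebraic_univ P)
      (isSemialgebraicFunOn_const_of_isAlgebraic isSemialgebraic_univ hc)).congr
      fun x _ => by simp
  convert h.isSemialgebraic_sep_neg using 1
  ext x
  simp [sub_neg]

/-- `{x | c < P(x)}` is `ℚ`-semialgebraic for `P ∈ ℚ[X₀, …, X_{n-1}]` and `c` real algebraic: it is
the negativity set of the `ℚ`-semialgebraic function `c − P`. [folklore] -/
theorem tre_isSemialgebraic_setOf_const_lt_aeval {n : ℕ} (P : MvPolynomial (Fin n) ℚ) {c : ℝ}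
    (hc : IsAlgebraic ℚ c) : IsSemialgebraic ℚ {x : Fin n → ℝ | c < aeval x P} := by
  have h : IsSemialgebraicFunOn ℚ (univ : Set (Fin n → ℝ)) (fun x => c - aeval x P) :=
    (IsSemialgebraicFunOn.sub_holds
      (isSemialgebraicFunOn_const_of_isAlgebraic isSemialgebraic_univ hc)
      (isSemialgebraicFunOn_aeval isSemialgebraic_univ P)).congr
      fun x _ => by simp
  convert h.isSemialgebraic_sep_neg using 1
  ext x
  simp [sub_neg]

/-! ## The slack condition -/

/-- The slack region `{0 < z, z · (x · y) < 1}` is `ℚ`-semialgebraic. [folklore] -/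
theorem tre_isSemialgebraic_slack :
    IsSemialgebraic ℚ {p : Fin 3 → ℝ | 0 < p 2 ∧ p 2 * (p 0 * p 1) < 1} := by
  have hz : IsSemialgebraic ℚ {p : Fin 3 → ℝ | 0 < p 2} := by
    have h := isSemialgebraic_setOf_eval_pos (k := ℚ) (R := ℝ) (X 2 : MvPolynomial (Fin 3) ℚ)
    simpa using h
  have hprod : IsSemialgebraic ℚ {p : Fin 3 → ℝ | p 2 * (p 0 * p 1) < 1} := by
    have h := isSemialgebraic_setOf_eval_lt (k := ℚ) (R := ℝ)
      (X 2 * (X 0 * X 1) : MvPolynomial (Fin 3) ℚ) (C 1)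
    simpa using h
  exact hz.inter hprod

/-! ## The log-triangle -/

/-- The log-triangle `{a < x, b < y, xⁱ yʲ < c, slack}` with real-algebraic `a, b, c` is
`ℚ`-semialgebraic. [folklore] -/
theorem tre_isSemialgebraic_tri {a b c : ℝ} (ha : IsAlgebraic ℚ a) (hb : IsAlgebraic ℚ b)
    (hc : IsAlgebraic ℚ c) (i j : ℕ) :
    IsSemialgebraic ℚ {p : Fin 3 → ℝ | a < p 0 ∧ b < p 1 ∧ p 0 ^ i * p 1 ^ j < c ∧ 0 < p 2 ∧
      p 2 * (p 0 * p 1) < 1} := by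
  have h0 : IsSemialgebraic ℚ {p : Fin 3 → ℝ | a < p 0} :=
    KZ.isSemialgebraic_setOf_const_lt_apply ha 0
  have h1 : IsSemialgebraic ℚ {p : Fin 3 → ℝ | b < p 1} :=
    KZ.isSemialgebraic_setOf_const_lt_apply hb 1
  have h2 : IsSemialgebraic ℚ {p : Fin 3 → ℝ | p 0 ^ i * p 1 ^ j < c} := by
    have h := tre_isSemialgebraic_setOf_aeval_lt_const
      (X 0 ^ i * X 1 ^ j : MvPolynomial (Fin 3) ℚ) hc
    simpa using h
  have hset : {p : Fin 3 → ℝ | a < p 0 ∧ b < p 1 ∧ p 0 ^ i * p 1 ^ j < c ∧ 0 < p 2 ∧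
      p 2 * (p 0 * p 1) < 1} = {p : Fin 3 → ℝ | a < p 0} ∩ {p | b < p 1} ∩
        {p | p 0 ^ i * p 1 ^ j < c} ∩ {p | 0 < p 2 ∧ p 2 * (p 0 * p 1) < 1} := by
    ext p
    simp [and_assoc]
  rw [hset]
  exact ((h0.inter h1).inter h2).inter tre_isSemialgebraic_slack

/-- The log-triangle over `(a, b)` with `a, b > 0` and `i, j ≥ 1` lies in a compact coordinate box:
`x ≤ max 1 (c / bʲ)` (as `x ≤ xⁱ` once `x ≥ 1` and `xⁱ bʲ ≤ xⁱ yʲ < c`), symmetrically for `y`,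
and `z < 1/(xy) < 1/(ab)`. [folklore] -/
theorem tre_tri_subset_Icc {a b c : ℝ} (ha : 0 < a) (hb : 0 < b) {i j : ℕ} (hi : 1 ≤ i)
    (hj : 1 ≤ j) :
    {p : Fin 3 → ℝ | a < p 0 ∧ b < p 1 ∧ p 0 ^ i * p 1 ^ j < c ∧ 0 < p 2 ∧
      p 2 * (p 0 * p 1) < 1} ⊆
    Icc (0 : Fin 3 → ℝ) (fun _ => max 1 (c / b ^ j) + max 1 (c / a ^ i) + (a * b)⁻¹) := by
  rintro p ⟨h0, h1, hc, hz, hprod⟩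
  have hx : 0 < p 0 := ha.trans h0
  have hy : 0 < p 1 := hb.trans h1
  have hxb : p 0 ≤ max 1 (c / b ^ j) := by
    rcases le_or_gt (p 0) 1 with hle | hlt
    · exact hle.trans (le_max_left _ _)
    · refine le_max_of_le_right ?_
      rw [le_div_iff₀ (pow_pos hb j)]
      calc p 0 * b ^ j ≤ p 0 ^ i * p 1 ^ j :=
            mul_le_mul (le_self_pow₀ hlt.le (by omega)) (pow_le_pow_left₀ hb.le h1.le j)
              (pow_pos hb j).le (pow_pos hx i).le
        _ ≤ c := hc.le
  have hya : p 1 ≤ max 1 (c / a ^ i) := by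
    rcases le_or_gt (p 1) 1 with hle | hlt
    · exact hle.trans (le_max_left _ _)
    · refine le_max_of_le_right ?_
      rw [le_div_iff₀ (pow_pos ha i)]
      calc p 1 * a ^ i = a ^ i * p 1 := mul_comm _ _
        _ ≤ p 0 ^ i * p 1 ^ j :=
            mul_le_mul (pow_le_pow_left₀ ha.le h0.le i) (le_self_pow₀ hlt.le (by omega))
              hy.le (pow_pos hx i).le
        _ ≤ c := hc.le
  have hzle : p 2 ≤ (a * b)⁻¹ := by
    rw [← one_div, le_div_iff₀ (mul_pos ha hb)]
    have hab : a * b ≤ p 0 * p 1 := mul_le_mul h0.le h1.le hb.le hx.le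
    nlinarith [mul_le_mul_of_nonneg_left hab hz.le]
  have hM1 : (0 : ℝ) ≤ max 1 (c / b ^ j) := le_max_of_le_left zero_le_one
  have hM2 : (0 : ℝ) ≤ max 1 (c / a ^ i) := le_max_of_le_left zero_le_one
  have hM3 : (0 : ℝ) ≤ (a * b)⁻¹ := (inv_pos.mpr (mul_pos ha hb)).le
  simp only [mem_Icc, Pi.le_def, Pi.zero_apply, Fin.forall_fin_succ, Fin.succ_zero_eq_one,
    Fin.succ_one_eq_two, IsEmpty.forall_iff, and_true]
  exact ⟨⟨hx.le, hy.le, hz.le⟩, by linarith, by linarith, by linarith⟩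

/-! ## The middle triangle -/

/-- The middle triangle `{1 < y < x < g, slack}` with real-algebraic `g` is `ℚ`-semialgebraic.
[folklore] -/
theorem tre_isSemialgebraic_mid {g : ℝ} (hg : IsAlgebraic ℚ g) :
    IsSemialgebraic ℚ {p : Fin 3 → ℝ | 1 < p 1 ∧ p 1 < p 0 ∧ p 0 < g ∧ 0 < p 2 ∧
      p 2 * (p 0 * p 1) < 1} := by
  have h0 : IsSemialgebraic ℚ {p : Fin 3 → ℝ | 1 < p 1} := by
    have h := isSemialgebraic_setOf_eval_lt (k := ℚ) (R := ℝ)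
      (C 1 : MvPolynomial (Fin 3) ℚ) (X 1)
    simpa using h
  have h1 : IsSemialgebraic ℚ {p : Fin 3 → ℝ | p 1 < p 0} := by
    have h := isSemialgebraic_setOf_eval_lt (k := ℚ) (R := ℝ)
      (X 1 : MvPolynomial (Fin 3) ℚ) (X 0)
    simpa using h
  have h2 : IsSemialgebraic ℚ {p : Fin 3 → ℝ | p 0 < g} :=
    KZ.isSemialgebraic_setOf_apply_lt_const hg 0
  have hset : {p : Fin 3 → ℝ | 1 < p 1 ∧ p 1 < p 0 ∧ p 0 < g ∧ 0 < p 2 ∧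
      p 2 * (p 0 * p 1) < 1} = {p : Fin 3 → ℝ | 1 < p 1} ∩ {p | p 1 < p 0} ∩ {p | p 0 < g} ∩
        {p | 0 < p 2 ∧ p 2 * (p 0 * p 1) < 1} := by
    ext p
    simp [and_assoc]
  rw [hset]
  exact ((h0.inter h1).inter h2).inter tre_isSemialgebraic_slack

/-- The middle triangle lies in the compact box `[0, max g 1]³` (`1 < y < x < g`, and `z < 1/(xy) < 1`).
[folklore] -/
theorem tre_mid_subset_Icc (g : ℝ) :
    {p : Fin 3 → ℝ | 1 < p 1 ∧ p 1 < p 0 ∧ p 0 < g ∧ 0 < p 2 ∧ p 2 * (p 0 * p 1) < 1} ⊆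
    Icc (0 : Fin 3 → ℝ) (fun _ => max g 1) := by
  rintro p ⟨h1, h10, h0g, hz, hprod⟩
  have hxy : 1 ≤ p 0 * p 1 := by nlinarith
  have hzle : p 2 ≤ 1 := by nlinarith [mul_le_mul_of_nonneg_left hxy hz.le]
  simp only [mem_Icc, Pi.le_def, Pi.zero_apply, Fin.forall_fin_succ, Fin.succ_zero_eq_one,
    Fin.succ_one_eq_two, IsEmpty.forall_iff, and_true]
  exact ⟨⟨by linarith, by linarith, hz.le⟩, le_max_of_le_left h0g.le,
    le_max_of_le_left (h10.le.trans h0g.le), le_max_of_le_right hzle⟩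

/-! ## The north-east triangle -/

/-- The north-east triangle `{0 < x < g, y < g, g < xy, slack}` with real-algebraic `g` is
`ℚ`-semialgebraic. [folklore] -/
theorem tre_isSemialgebraic_ne {g : ℝ} (hg : IsAlgebraic ℚ g) :
    IsSemialgebraic ℚ {p : Fin 3 → ℝ | 0 < p 0 ∧ p 0 < g ∧ p 1 < g ∧ g < p 0 * p 1 ∧ 0 < p 2 ∧
      p 2 * (p 0 * p 1) < 1} := by
  have h0 : IsSemialgebraic ℚ {p : Fin 3 → ℝ | 0 < p 0} := by
    have h := isSemialgebraic_setOf_eval_pos (k := ℚ) (R := ℝ) (X 0 : MvPolynomial (Fin 3) ℚ)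
    simpa using h
  have h1 : IsSemialgebraic ℚ {p : Fin 3 → ℝ | p 0 < g} :=
    KZ.isSemialgebraic_setOf_apply_lt_const hg 0
  have h2 : IsSemialgebraic ℚ {p : Fin 3 → ℝ | p 1 < g} :=
    KZ.isSemialgebraic_setOf_apply_lt_const hg 1
  have h3 : IsSemialgebraic ℚ {p : Fin 3 → ℝ | g < p 0 * p 1} := by
    have h := tre_isSemialgebraic_setOf_const_lt_aeval (X 0 * X 1 : MvPolynomial (Fin 3) ℚ) hg
    simpa using h
  have hset : {p : Fin 3 → ℝ | 0 < p 0 ∧ p 0 < g ∧ p 1 < g ∧ g < p 0 * p 1 ∧ 0 < p 2 ∧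
      p 2 * (p 0 * p 1) < 1} = {p : Fin 3 → ℝ | 0 < p 0} ∩ {p | p 0 < g} ∩ {p | p 1 < g} ∩
        {p | g < p 0 * p 1} ∩ {p | 0 < p 2 ∧ p 2 * (p 0 * p 1) < 1} := by
    ext p
    simp [and_assoc]
  rw [hset]
  exact (((h0.inter h1).inter h2).inter h3).inter tre_isSemialgebraic_slack

/-- The north-east triangle lies in the compact box `[0, max g g⁻¹]³`: `0 < x < g` forces `g > 0`,
`xy > g > 0` forces `y > 0`, and `z < 1/(xy) < 1/g`. [folklore] -/
theorem tre_ne_subset_Icc (g : ℝ) :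
    {p : Fin 3 → ℝ | 0 < p 0 ∧ p 0 < g ∧ p 1 < g ∧ g < p 0 * p 1 ∧ 0 < p 2 ∧
      p 2 * (p 0 * p 1) < 1} ⊆
    Icc (0 : Fin 3 → ℝ) (fun _ => max g g⁻¹) := by
  rintro p ⟨hx, hxg, hyg, hgxy, hz, hprod⟩
  have hg : 0 < g := hx.trans hxg
  have hy : 0 < p 1 := pos_of_mul_pos_right (hg.trans hgxy) hx.le
  have hzle : p 2 ≤ g⁻¹ := by
    rw [← one_div, le_div_iff₀ hg]
    nlinarith [mul_le_mul_of_nonneg_left hgxy.le hz.le]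
  simp only [mem_Icc, Pi.le_def, Pi.zero_apply, Fin.forall_fin_succ, Fin.succ_zero_eq_one,
    Fin.succ_one_eq_two, IsEmpty.forall_iff, and_true]
  exact ⟨⟨hx.le, hy.le, hz.le⟩, le_max_of_le_left hxg.le, le_max_of_le_left hyg.le,
    le_max_of_le_right hzle⟩

/-! ## The stub -/

/-- **Stub (triangle representations exist).** For `a, b > 0` and `c` real algebraic and
`i, j ≥ 1`, the log-triangle `{a < x, b < y, xⁱyʲ < c, 0 < z, z·xy < 1}` carries an integrand-`1`
representation (it is `ℚ`-semialgebraic and bounded); likewise the middle triangle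
`{1 < y < x < g}` and the north-east triangle `{0 < x < g, y < g, xy > g}` over the same slack,
for `g` real algebraic (`KZ.exists_oneRep`). [folklore] -/
theorem stub_triExists : ((∀ (a b c : ℝ) (i j : ℕ), 0 < a → 0 < b → IsAlgebraic ℚ a → IsAlgebraic ℚ b → IsAlgebraic ℚ c → 1 ≤ i → 1 ≤ j → ∃ r : KZ.IntegralRep 3, r.domain = {p : Fin 3 → ℝ | a < p 0 ∧ b < p 1 ∧ p 0 ^ i * p 1 ^ j < c ∧ 0 < p 2 ∧ p 2 * (p 0 * p 1) < 1} ∧ r.integrand = fun _ => 1) ∧ (∀ g : ℝ, IsAlgebraic ℚ g → ∃ r : KZ.IntegralRep 3, r.domain = {p : Fin 3 → ℝ | 1 < p 1 ∧ p 1 < p 0 ∧ p 0 < g ∧ 0 < p 2 ∧ p 2 * (p 0 * p 1) < 1} ∧ r.integrand = fun _ => 1) ∧ (∀ g : ℝ, IsAlgebraic ℚ g → ∃ r : KZ.IntegralRep 3, r.domain = {p : Fin 3 → ℝ | 0 < p 0 ∧ p 0 < g ∧ p 1 < g ∧ g < p 0 * p 1 ∧ 0 < p 2 ∧ p 2 *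 (p 0 * p 1) < 1} ∧ r.integrand = fun _ => 1)) := by
  refine ⟨fun a b c i j ha hb halg hbalg hcalg hi hj => ?_, fun g hg => ?_, fun g hg => ?_⟩
  · exact KZ.exists_oneRep (tre_isSemialgebraic_tri halg hbalg hcalg i j)
      (((measure_mono (tre_tri_subset_Icc (c := c) ha hb hi hj)).trans_lt
        isCompact_Icc.measure_lt_top).ne)
  · exact KZ.exists_oneRep (tre_isSemialgebraic_mid hg)
      (((measure_mono (tre_mid_subset_Icc g)).trans_lt isCompact_Icc.measure_lt_top).ne)
  · exact KZ.exists_oneRep (tre_isSemialgebraic_ne hg)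
      (((measure_mono (tre_ne_subset_Icc g)).trans_lt isCompact_Icc.measure_lt_top).ne)

end Summit.KontsevichZagierPeriods.SymplecticScissors.LogPolytope

end
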